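import Mathlib
import Summits.NavierStokesRegularity.NavierStokesRegularity.Theorems.EulerZoomLiouvillePowerGaugeEulerLiouvilleSelfSimilarWeakHomogeneousTailTools
import Summits.NavierStokesRegularity.NavierStokesRegularity.Theorems.EulerZoomLiouvillePowerGaugeEulerLiouvilleEnergySaturationMember
import Summits.NavierStokesRegularity.NavierStokesRegularity.Theorems.EulerZoomLiouvillePowerGaugeEulerLiouvilleSelfSimilarPastSubExtremal
import HarnessLib

/-!
# Weak self-similar profiles with a (dyadically) homogeneous tail of OFF-natural degree are trivial
# (Chae–Shvydkoy 2013, Thm 4.2 (i)–(ii), inside Seregin's class, no regularity)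

Route №10 `EulerZoomLiouville` (NavierStokesRegularity), crux E = stmt-NavierStokesRegularity-19832,
registered open stub `stub_selfSimilarWeakRest`.  Chae–Shvydkoy (ARMA 209 (2013) = arXiv:1201.6009,
§4.1 Thm 4.2) exclude `C¹_loc` self-similar Euler profiles which are HOMOGENEOUS NEAR INFINITY,
`v(y) = W(y/|y|)/|y|^β` for large `|y|`, whenever the degree is not the natural one: (i) `0 < β < α`,
(ii) `−1 < α < β` (`α = 1+ρ` in the crux's exponents); the natural degree `β = 1+ρ` is Shvydkoy's
homogeneous stationary problem (tree: `…SelfSimilarShvydkoyTail`, open for `α ∈ (1, 3/2]`).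

Inside Seregin's power-gauged class both (i) and (ii) are GAUGE ARITHMETIC and need neither `C¹` nor
the profile equation — and the weaker DYADIC homogeneity `V(2y) = 2^{−β} V(y)` (`|y| ≥ R₀`) suffices
(it includes log-periodically modulated tails `|y|^{−β} W(y/|y|, log₂|y| mod 1)`).  With the dyadic
shells `S_k = {2^k R₀ ≤ |y| < 2^{k+1} R₀}` and `m = ∫_{S_0} |V|²`:
`∫_{S_k} |V|² = 2^{k(3−2β)} m` (`WeakTail.lintegral_shell_eq_of_dyadicHomogeneous_rpow`, tools file
`…SelfSimilarWeakHomogeneousTailTools`), while the `A`-gauge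
pins `∫_{B_L}|V|² ≤ c L^{1−2ρ}` and extremality asks `∫_{B_L}|V|² ≥ ε L^{1−2ρ}`:

* `m = 0` ⇒ the tail is null, the profile lives in `B_{R₀}`, so for `ρ < 1/2` it is SUB-EXTREMAL
  (`WeakTail.subExtremal_of_tail_ae_zero`) and the member dies by
  `EnergySaturation.selfSimilar_ae_eq_zero_of_subExtremal`;
* `m ≠ 0`, `β < 1+ρ` (`3−2β > 1−2ρ`): the shell energy alone outgrows the `A`-gauge — no such member;
* `m ≠ 0`, `β > 1+ρ`, `ρ < 1/2` (`3−2β < 1−2ρ`): `∫_{B_{2^K R₀}}|V|² ≤ ∫_{B_{R₀}}|V|² + m Σ_{k<K} 2^{k(3−2β)}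
  ≲ 2^{K s'}` with `s' = max(3−2β, (1−2ρ)/2) < 1−2ρ`, so the normalised energy tends to `0` along
  `L = 2^K R₀`: SUB-EXTREMAL again.

Main results:
* `WeakTail.subExtremal_of_dyadicHomogeneousTail` — profile level: measurable `V` with the
  LARGE-SCALE growth `∫_{B_L}|V|² ≤ c L^{1−2ρ}` (`L ≥ 1`, `ρ < 1/2`) and a dyadically homogeneous tail
  of degree `−β`, `β ≠ 1+ρ`, is sub-extremal (the `hsub` binder of the fillers);
* `WeakTail.selfSimilar_ae_eq_zero_of_dyadicHomogeneousTail` — member level, centred: crux hypotheses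
  verbatim, `0 < ρ < 1/2`, exactly self-similar about the origin, `β ≠ 1+ρ`,
  `V(2y) = 2^{−β} V(y)` for `|y| ≥ R₀ > 0` ⇒ the member is trivial (**CS13 Thm 4.2 (i)+(ii) in the weak
  class**, any `β ∈ ℝ`, growing tails `β ≤ 0` included);
* `WeakTail.selfSimilar_ae_eq_zero_of_dyadicHomogeneousTail_past` — the same for members exactly
  self-similar about any `(T, x₀)` on a past sub-slab (large-scale data `Past.exists_locData_of_past`,
  filler `Past.selfSimilar_ae_eq_zero_of_subExtremal_past`).
The endpoint `ρ = 1/2` (tail of degree `−β`, `β < 4` ⇒ compactly supported profile) is the sequel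
`…SelfSimilarWeakHomogeneousTailEndpoint`.

WHAT THIS IS NOT: not NS, not E, not the stub — the natural degree `β = 1+ρ` (Shvydkoy's conjecture)
and the endpoint's compactly supported / super-drained profiles are untouched.
[cite: ChaeShvydkoy2013, §4.1 Thm. 4.2]
-/

noncomputable section

-- flat `Theorems/<Route><Decl>…` files of one crux share the namespace of the crux (tree convention)
set_option linter.dupNamespace false

open MeasureTheory Set Filter Topology Metric Function TopologicalSpace Finset
open scoped ENNReal NNReal

namespace Summit.NavierStokesRegularity.NavierStokesRegularity.Theorems.PowerGaugeEulerLiouville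

open Literature.Analysis Literature.Analysis.FunctionSpaces Literature.Analysis.FluidPDE

namespace WeakTail

section Member

/-- **The profile-level gauge arithmetic of an off-natural dyadically homogeneous tail.**  Let
`V : ℝ³ → ℝ³` be measurable with the LARGE-SCALE `A`-growth `∫_{B_L}|V|² ≤ c L^{1−2ρ}` (`L ≥ 1`,
`ρ < 1/2`), and `V (2 • y) = 2^{−β} • V y` for `|y| ≥ R₀ > 0` with `β ≠ 1 + ρ` (any real `β`).  Then
the profile is SUB-EXTREMAL (the `hsub` shape of the fillers).  With `m = ∫_{S_0}|V|²` over the first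
dyadic shell beyond `max R₀ 1`: `m = 0` ⇒ null tail ⇒ sub-extremal; `m ≠ 0` and `β < 1+ρ` ⇒ the shell
energies `2^{k(3−2β)} m` outgrow the growth bound — impossible; `m ≠ 0` and `β > 1+ρ` ⇒ the ball
energies along `L = 2^K max(R₀,1)` are `≲ 2^{K s'}`, `s' = max(3−2β, (1−2ρ)/2) < 1−2ρ` ⇒ sub-extremal.
[cite: ChaeShvydkoy2013, §4.1 Thm. 4.2 (i)–(ii)] -/
theorem subExtremal_of_dyadicHomogeneousTail {ρ : ℝ} (hρ2 : ρ < 1 / 2) {c : ℝ≥0}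
    {V : EuclideanSpace ℝ (Fin 3) → EuclideanSpace ℝ (Fin 3)} (hVm : AEStronglyMeasurable V volume)
    (hA : ∀ L : ℝ, 1 ≤ L → ∫⁻ y in ball (0 : EuclideanSpace ℝ (Fin 3)) L, ‖V y‖ₑ ^ 2 ≤
      (c : ℝ≥0∞) * ENNReal.ofReal (L ^ (1 - 2 * ρ)))
    {β R₀' : ℝ} (hR₀' : 0 < R₀') (hβ : β ≠ 1 + ρ)
    (hhom' : ∀ y : EuclideanSpace ℝ (Fin 3), R₀' ≤ ‖y‖ → V ((2 : ℝ) • y) = ((2 : ℝ) ^ (-β)) • V y) :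
    ∀ ε : ℝ, 0 < ε → ∀ L₀ : ℝ, ∃ L : ℝ, L₀ ≤ L ∧
      L ^ (2 * ρ - 1) * ∫ y in ball (0 : EuclideanSpace ℝ (Fin 3)) L, ‖V y‖ ^ 2 < ε := by
  have hV2 : LocallyIntegrable (fun y => ‖V y‖ ^ 2) volume :=
    EnergySaturation.locallyIntegrable_norm_sq_of_growth_loc hVm hA
  -- WLOG the homogeneity threshold is `≥ 1`
  set R₀ : ℝ := max R₀' 1 with hR₀def
  have hR₀ : 0 < R₀ := lt_of_lt_of_le one_pos (le_max_right _ _)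
  have hR₀1 : 1 ≤ R₀ := le_max_right _ _
  have hhom : ∀ y : EuclideanSpace ℝ (Fin 3), R₀ ≤ ‖y‖ → V ((2 : ℝ) • y) = ((2 : ℝ) ^ (-β)) • V y :=
    fun y hy => hhom' y ((le_max_left _ _).trans hy)
  -- the shell energies `e k = 2^{k s} m`, `s = 3 - 2β`
  set m : ℝ≥0∞ := ∫⁻ y in {y : EuclideanSpace ℝ (Fin 3) | R₀ ≤ ‖y‖ ∧ ‖y‖ < 2 * R₀}, ‖V y‖ₑ ^ 2 with hm
  set s : ℝ := 3 - 2 * β with hs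
  set t : ℝ := 1 - 2 * ρ with ht
  have ht0 : 0 < t := by rw [ht]; linarith
  have hshell : ∀ k : ℕ, ∫⁻ y in {y : EuclideanSpace ℝ (Fin 3) | (2 : ℝ) ^ k * R₀ ≤ ‖y‖ ∧
      ‖y‖ < (2 : ℝ) ^ (k + 1) * R₀}, ‖V y‖ₑ ^ 2 = ENNReal.ofReal ((2 : ℝ) ^ (s * k)) * m := fun k =>
    lintegral_shell_eq_of_dyadicHomogeneous_rpow hR₀ hhom k
  by_cases hm0 : m = 0
  · -- null tail ⇒ sub-extremal
    refine subExtremal_of_tail_ae_zero (R₀ := R₀) hρ2 hV2 ?_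
    rw [lintegral_tail_eq_tsum_shells hR₀]
    simp only [hshell, hm0, mul_zero, tsum_zero]
  -- `m ≠ 0`; the `A`-gauge makes `m` and every shell finite
  have hSk_le : ∀ k : ℕ, ENNReal.ofReal ((2 : ℝ) ^ (s * k)) * m ≤
      (c : ℝ≥0∞) * ENNReal.ofReal (((2 : ℝ) ^ (k + 1) * R₀) ^ t) := by
    intro k
    rw [← hshell k]
    have hsub : {y : EuclideanSpace ℝ (Fin 3) | (2 : ℝ) ^ k * R₀ ≤ ‖y‖ ∧ ‖y‖ < (2 : ℝ) ^ (k + 1) * R₀} ⊆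
        ball (0 : EuclideanSpace ℝ (Fin 3)) ((2 : ℝ) ^ (k + 1) * R₀) := by
      intro y hy
      rw [mem_ball, dist_zero_right]
      exact hy.2
    exact (lintegral_mono_set hsub).trans
      (hA _ (one_le_mul_of_one_le_of_one_le (one_le_pow₀ (by norm_num)) hR₀1))
  rcases lt_or_gt_of_ne hβ with hlt | hgt
  · -- `β < 1 + ρ`: `s > t`, the shells outgrow the gauge: impossible
    exfalso
    have hst : t < s := by rw [hs, ht]; linarith
    -- `m ≤ c (2R₀)^t · 2^{-k(s-t)}` for every `k`
    have hmk : ∀ k : ℕ, m ≤ ENNReal.ofReal ((c : ℝ) * (2 * R₀) ^ t * (2 : ℝ) ^ (-((s - t) * k))) := by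
      intro k
      have h := hSk_le k
      have h2k : (0 : ℝ) < (2 : ℝ) ^ (s * k) := by positivity
      have e1 : ((2 : ℝ) ^ (k + 1) * R₀) ^ t = (2 * R₀) ^ t * (2 : ℝ) ^ (t * k) := by
        rw [pow_succ, show (2 : ℝ) ^ k * 2 * R₀ = (2 * R₀) * (2 : ℝ) ^ k by ring,
          Real.mul_rpow (by positivity) (by positivity), ← Real.rpow_natCast,
          ← Real.rpow_mul (by norm_num : (0 : ℝ) ≤ 2), mul_comm (k : ℝ) t]
      rw [e1] at h
      -- divide by `ofReal (2^{s k})`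
      have h3 : m ≤ (c : ℝ≥0∞) * ENNReal.ofReal ((2 * R₀) ^ t * (2 : ℝ) ^ (t * k)) /
          ENNReal.ofReal ((2 : ℝ) ^ (s * k)) := by
        rw [ENNReal.le_div_iff_mul_le (Or.inl ((ENNReal.ofReal_pos.2 h2k).ne'))
          (Or.inl ENNReal.ofReal_ne_top), mul_comm]
        exact h
      refine h3.trans (le_of_eq ?_)
      rw [← ENNReal.ofReal_coe_nnreal, ← ENNReal.ofReal_mul (NNReal.coe_nonneg c),
        ← ENNReal.ofReal_div_of_pos h2k]
      congr 1
      rw [mul_div_assoc, mul_assoc]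
      congr 1
      rw [mul_div_assoc]
      congr 1
      rw [div_eq_iff h2k.ne', ← Real.rpow_add (by norm_num : (0 : ℝ) < 2)]
      congr 1
      ring
    have hlim : Tendsto (fun k : ℕ => ENNReal.ofReal ((c : ℝ) * (2 * R₀) ^ t * (2 : ℝ) ^ (-((s - t) * k))))
        atTop (𝓝 0) := by
      have h1 : Tendsto (fun k : ℕ => (2 : ℝ) ^ (-((s - t) * k))) atTop (𝓝 0) :=
        tendsto_two_rpow_neg_mul (by linarith : 0 < s - t)
      have h2 := h1.const_mul ((c : ℝ) * (2 * R₀) ^ t)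
      rw [mul_zero] at h2
      have h3 := ENNReal.tendsto_ofReal h2
      rwa [ENNReal.ofReal_zero] at h3
    have hm_le : m ≤ 0 := le_of_tendsto_of_tendsto tendsto_const_nhds hlim (Eventually.of_forall hmk)
    exact hm0 (le_antisymm hm_le bot_le)
  · -- `β > 1 + ρ`: `s < t`, sub-extremal along `L = 2^K R₀`
    have hst : s < t := by rw [hs, ht]; linarith
    intro ε hε L₀
    have hmtop : m ≠ ⊤ := by
      have h := hSk_le 0
      simp only [CharP.cast_eq_zero, mul_zero, Real.rpow_zero, ENNReal.ofReal_one, one_mul,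
        zero_add, pow_one] at h
      exact ne_top_of_le_ne_top (ENNReal.mul_ne_top ENNReal.coe_ne_top ENNReal.ofReal_ne_top) h
    set s' : ℝ := max s (t / 2) with hs'
    have hs'0 : 0 < s' := lt_of_lt_of_le (by linarith) (le_max_right _ _)
    have hs't : s' < t := max_lt hst (by linarith)
    have h2s' : (1 : ℝ) < (2 : ℝ) ^ s' := Real.one_lt_rpow (by norm_num) hs'0
    -- the real geometric bound `Σ_{k<K} 2^{s k} ≤ 2^{s' K} / (2^{s'} - 1)`
    have hgeom : ∀ K : ℕ, ∑ k ∈ Finset.range K, (2 : ℝ) ^ (s * k) ≤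
        (2 : ℝ) ^ (s' * K) / ((2 : ℝ) ^ s' - 1) := by
      intro K
      have hle : ∑ k ∈ Finset.range K, (2 : ℝ) ^ (s * k) ≤ ∑ k ∈ Finset.range K, ((2 : ℝ) ^ s') ^ k := by
        refine Finset.sum_le_sum fun k _ => ?_
        rw [← Real.rpow_natCast, ← Real.rpow_mul (by positivity)]
        exact Real.rpow_le_rpow_of_exponent_le (by norm_num)
          (mul_le_mul_of_nonneg_right (le_max_left _ _) (Nat.cast_nonneg k))
      refine hle.trans ?_
      rw [geom_sum_eq h2s'.ne', ← Real.rpow_natCast, ← Real.rpow_mul (by positivity)]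
      exact div_le_div_of_nonneg_right (by linarith) (by linarith)
    -- the quantities in play, as reals
    set X : ℝ≥0∞ := ∫⁻ y in ball (0 : EuclideanSpace ℝ (Fin 3)) R₀, ‖V y‖ₑ ^ 2 with hX
    have hXtop : X ≠ ⊤ := (LpProfile.lintegral_ball_sq_lt_top hV2 R₀).ne
    set D : ℝ := m.toReal / ((2 : ℝ) ^ s' - 1) with hD
    have hD0 : 0 ≤ D := div_nonneg ENNReal.toReal_nonneg (by linarith)
    -- ball energy at `L = 2^K R₀` (real form)
    have hballK : ∀ K : ℕ, ∫ y in ball (0 : EuclideanSpace ℝ (Fin 3)) ((2 : ℝ) ^ K * R₀), ‖V y‖ ^ 2 ≤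
        X.toReal + D * (2 : ℝ) ^ (s' * K) := by
      intro K
      rw [LpProfile.integral_ball_sq_eq_toReal hV2]
      have h := lintegral_ball_le_add_sum_shells (V := V) R₀ K
      simp only [hshell] at h
      have hsum_top : ∑ k ∈ Finset.range K, ENNReal.ofReal ((2 : ℝ) ^ (s * k)) * m ≠ ⊤ :=
        ENNReal.sum_ne_top.2 fun k _ => ENNReal.mul_ne_top ENNReal.ofReal_ne_top hmtop
      refine (ENNReal.toReal_mono (ENNReal.add_ne_top.2 ⟨hXtop, hsum_top⟩) h).trans ?_
      rw [ENNReal.toReal_add hXtop hsum_top, ENNReal.toReal_sum (fun k _ =>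
        ENNReal.mul_ne_top ENNReal.ofReal_ne_top hmtop)]
      refine add_le_add le_rfl ?_
      have e : ∀ k ∈ Finset.range K, (ENNReal.ofReal ((2 : ℝ) ^ (s * k)) * m).toReal =
          (2 : ℝ) ^ (s * k) * m.toReal := fun k _ => by
        rw [ENNReal.toReal_mul, ENNReal.toReal_ofReal (by positivity)]
      rw [Finset.sum_congr rfl e, ← Finset.sum_mul]
      calc (∑ k ∈ Finset.range K, (2 : ℝ) ^ (s * k)) * m.toReal
          ≤ (2 : ℝ) ^ (s' * K) / ((2 : ℝ) ^ s' - 1) * m.toReal :=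
            mul_le_mul_of_nonneg_right (hgeom K) ENNReal.toReal_nonneg
        _ = D * (2 : ℝ) ^ (s' * K) := by rw [hD]; ring
    -- choose `K` large: `(2^K R₀)^{-t} (X + D 2^{s' K}) < ε` and `2^K R₀ ≥ L₀`
    have hlim : Tendsto (fun K : ℕ => ((2 : ℝ) ^ K * R₀) ^ (2 * ρ - 1) * (X.toReal + D * (2 : ℝ) ^ (s' * K)))
        atTop (𝓝 0) := by
      -- `= R₀^{-t} (X 2^{-tK} + D 2^{-(t-s')K})`
      have e : ∀ K : ℕ, ((2 : ℝ) ^ K * R₀) ^ (2 * ρ - 1) * (X.toReal + D * (2 : ℝ) ^ (s' * K)) =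
          R₀ ^ (2 * ρ - 1) * (X.toReal * (2 : ℝ) ^ (-(t * K)) + D * (2 : ℝ) ^ (-((t - s') * K))) := by
        intro K
        rw [Real.mul_rpow (by positivity) hR₀.le, ← Real.rpow_natCast, ← Real.rpow_mul (by norm_num),
          show (K : ℝ) * (2 * ρ - 1) = -(t * K) by rw [ht]; ring]
        have : (2 : ℝ) ^ (-(t * K)) * (2 : ℝ) ^ (s' * K) = (2 : ℝ) ^ (-((t - s') * K)) := by
          rw [← Real.rpow_add (by norm_num : (0 : ℝ) < 2)]; congr 1; ring
        rw [← this]; ring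
      simp_rw [e]
      have h2 : ∀ a : ℝ, 0 < a → Tendsto (fun K : ℕ => (2 : ℝ) ^ (-(a * K))) atTop (𝓝 0) :=
        fun a ha => tendsto_two_rpow_neg_mul ha
      have hA' := (h2 t ht0).const_mul X.toReal
      have hB' := (h2 (t - s') (by linarith)).const_mul D
      rw [mul_zero] at hA' hB'
      have := (hA'.add hB').const_mul (R₀ ^ (2 * ρ - 1))
      rwa [add_zero, mul_zero] at this
    have hgrow : Tendsto (fun K : ℕ => (2 : ℝ) ^ K * R₀) atTop atTop :=
      (tendsto_pow_atTop_atTop_of_one_lt (by norm_num : (1 : ℝ) < 2)).atTop_mul_const hR₀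
    obtain ⟨K, hK1, hK2⟩ := ((hlim.eventually (gt_mem_nhds hε)).and
      (hgrow.eventually_ge_atTop L₀)).exists
    refine ⟨(2 : ℝ) ^ K * R₀, hK2, lt_of_le_of_lt ?_ hK1⟩
    exact mul_le_mul_of_nonneg_left (hballK K) (Real.rpow_nonneg (by positivity) _)

/-- **Chae–Shvydkoy's Thm 4.2 (i)+(ii) in the weak class, centred.**  Let `(u, p, H, c)` satisfy the
three hypotheses of the crux `PowerGaugeEulerLiouville` with `0 < ρ < 1/2` and be exactly self-similar
about the origin with profile `(V, P)`.  If the velocity profile has a DYADICALLY HOMOGENEOUS TAIL of a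
degree `−β` OTHER than the natural `−(1+ρ)` — `V (2 • y) = 2^{−β} • V y` for `|y| ≥ R₀ > 0`,
`β ≠ 1 + ρ`, any real `β`, no regularity — then the member is trivial
(`subExtremal_of_dyadicHomogeneousTail` + `EnergySaturation.selfSimilar_ae_eq_zero_of_subExtremal`).
[cite: ChaeShvydkoy2013, §4.1 Thm. 4.2 (i)–(ii)] -/
theorem selfSimilar_ae_eq_zero_of_dyadicHomogeneousTail {ρ : ℝ} (hρ : 0 < ρ) (hρ2 : ρ < 1 / 2)
    {u : ℝ → EuclideanSpace ℝ (Fin 3) → EuclideanSpace ℝ (Fin 3)} {p : ℝ → EuclideanSpace ℝ (Fin 3) → ℝ}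
    {H : ℝ → EuclideanSpace ℝ (Fin 3) → EuclideanSpace ℝ (Fin 3) →L[ℝ] EuclideanSpace ℝ (Fin 3)} {c : ℝ≥0}
    (hsw : IsSuitableWeakSolutionOn (slab (EuclideanSpace ℝ (Fin 3)) (Iio 0) isOpen_Iio) 0 0 u p)
    (hH : HasWeakSpatialGradientOn (slab (EuclideanSpace ℝ (Fin 3)) (Iio 0) isOpen_Iio) u H)
    (hgauge : ∀ a : ℝ, 0 < a →
      ENNReal.ofReal (a ^ (2 * ρ)) * cknA a (0 : ℝ × EuclideanSpace ℝ (Fin 3)) u +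
          ENNReal.ofReal (a ^ ρ) * cknE a (0 : ℝ × EuclideanSpace ℝ (Fin 3)) H +
        ENNReal.ofReal (a ^ (2 * ρ)) * cknD a (0 : ℝ × EuclideanSpace ℝ (Fin 3)) p ≤ (c : ℝ≥0∞))
    {V : EuclideanSpace ℝ (Fin 3) → EuclideanSpace ℝ (Fin 3)} {P : EuclideanSpace ℝ (Fin 3) → ℝ}
    (hu : ∀ τ : ℝ, τ < 0 → u τ = selfSimilarCollapse (1 / (2 + ρ)) 0 V τ)
    (hp : ∀ τ : ℝ, τ < 0 → p τ = selfSimilarCollapsePressure (1 / (2 + ρ)) 0 P τ)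
    {β R₀ : ℝ} (hR₀ : 0 < R₀) (hβ : β ≠ 1 + ρ)
    (hhom : ∀ y : EuclideanSpace ℝ (Fin 3), R₀ ≤ ‖y‖ → V ((2 : ℝ) • y) = ((2 : ℝ) ^ (-β)) • V y) :
    uncurry u =ᵐ[volume.restrict (Iio (0 : ℝ) ×ˢ (univ : Set (EuclideanSpace ℝ (Fin 3))))] 0 := by
  obtain ⟨G, -, hVm, -, -, -, hA, -⟩ :=
    EnergySaturation.profileData_of_selfSimilar hρ (by linarith) hsw hH hgauge hu hp
  exact EnergySaturation.selfSimilar_ae_eq_zero_of_subExtremal hρ (by linarith) hsw hH hgauge hu hp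
    (subExtremal_of_dyadicHomogeneousTail hρ2 hVm (fun L hL => hA L (by linarith)) hR₀ hβ hhom)

/-- **Chae–Shvydkoy's Thm 4.2 (i)+(ii) in the weak class, past/shifted** (`0 < ρ < 1/2`): a member that
is exactly self-similar about `(T, x₀)` on a past sub-slab `τ < T₁` (`T₁ ≤ 0`, `T₁ ≤ T`) whose velocity
profile has a dyadically homogeneous tail of degree `−β`, `β ≠ 1 + ρ`, is trivial (the large-scale data
`Past.exists_locData_of_past` suffice: the shells live at radii `≥ 1`; then
`Past.selfSimilar_ae_eq_zero_of_subExtremal_past`). [cite: ChaeShvydkoy2013, §4.1 Thm. 4.2 (i)–(ii)] -/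
theorem selfSimilar_ae_eq_zero_of_dyadicHomogeneousTail_past {ρ : ℝ} (hρ : 0 < ρ) (hρ2 : ρ < 1 / 2)
    {T T₁ : ℝ} (hT₁ : T₁ ≤ 0) (hTT₁ : T₁ ≤ T) (x₀ : EuclideanSpace ℝ (Fin 3))
    {u : ℝ → EuclideanSpace ℝ (Fin 3) → EuclideanSpace ℝ (Fin 3)} {p : ℝ → EuclideanSpace ℝ (Fin 3) → ℝ}
    {H : ℝ → EuclideanSpace ℝ (Fin 3) → EuclideanSpace ℝ (Fin 3) →L[ℝ] EuclideanSpace ℝ (Fin 3)} {c : ℝ≥0}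
    (hsw : IsSuitableWeakSolutionOn (slab (EuclideanSpace ℝ (Fin 3)) (Iio 0) isOpen_Iio) 0 0 u p)
    (hH : HasWeakSpatialGradientOn (slab (EuclideanSpace ℝ (Fin 3)) (Iio 0) isOpen_Iio) u H)
    (hgauge : ∀ a : ℝ, 0 < a →
      ENNReal.ofReal (a ^ (2 * ρ)) * cknA a (0 : ℝ × EuclideanSpace ℝ (Fin 3)) u +
          ENNReal.ofReal (a ^ ρ) * cknE a (0 : ℝ × EuclideanSpace ℝ (Fin 3)) H +
        ENNReal.ofReal (a ^ (2 * ρ)) * cknD a (0 : ℝ × EuclideanSpace ℝ (Fin 3)) p ≤ (c : ℝ≥0∞))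
    {V : EuclideanSpace ℝ (Fin 3) → EuclideanSpace ℝ (Fin 3)} {P : EuclideanSpace ℝ (Fin 3) → ℝ}
    (hu : ∀ τ : ℝ, τ < T₁ → u τ = fun x => selfSimilarCollapse (1 / (2 + ρ)) T V τ (x - x₀))
    (hp : ∀ τ : ℝ, τ < T₁ → p τ = fun x => selfSimilarCollapsePressure (1 / (2 + ρ)) T P τ (x - x₀))
    {β R₀ : ℝ} (hR₀ : 0 < R₀) (hβ : β ≠ 1 + ρ)
    (hhom : ∀ y : EuclideanSpace ℝ (Fin 3), R₀ ≤ ‖y‖ → V ((2 : ℝ) • y) = ((2 : ℝ) ^ (-β)) • V y) :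
    uncurry u =ᵐ[volume.restrict (Iio (0 : ℝ) ×ˢ (univ : Set (EuclideanSpace ℝ (Fin 3))))] 0 := by
  obtain ⟨G, c', hVm, -, -, -, hA₁, -⟩ :=
    Past.exists_locData_of_past hρ hρ2.le hT₁ hTT₁ x₀ hsw hH hgauge hu hp
  exact Past.selfSimilar_ae_eq_zero_of_subExtremal_past hρ hρ2.le hT₁ hTT₁ x₀ hsw hH hgauge hu hp
    (subExtremal_of_dyadicHomogeneousTail hρ2 hVm hA₁ hR₀ hβ hhom)

end Member



end WeakTail

end Summit.NavierStokesRegularity.NavierStokesRegularity.Theorems.PowerGaugeEulerLiouville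

end
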